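import Mathlib
import Literature.Computability.AlgebraicComplexity.SymmetricArithCircuit

/-!
# Route ProofCarryingSymmetry — crux `RestorationQP`, line `registered`: heights and a topological numbering of a labelled circuit

B-core″, part 3a.  To lay a Dawar–Wilsenach labelled circuit (`LabelledArithCircuit`, a
well-founded DAG on a finite gate type `G`) out as a Hrubeš–Tzameret straight-line circuit we need a
numbering of the gates in which children come before parents.  This file provides it:

* `height D g` — the length of a longest wire path below `g` (well-founded recursion),
  `height_lt_of_mem_children`, and the bound `height D g < Fintype.card G` (the gates of heights
  `0, 1, …, height g` below `g` are distinct);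
* `topKey D g = height g · |G| + idx g` (`idx` an enumeration of `G`): injective, increasing along
  wires, and `< |G|²` (`topKey_injective`, `topKey_lt_of_mem_children`, `topKey_lt`).

Registered helper: `proofsToACEquiv_aux_numbering`.  Everything proved; no named facts.
-/

-- single-problem summit: `Summit.ValiantsHypothesis.ValiantsHypothesis.…` is the namespace by design (D-0017)
set_option linter.dupNamespace false

noncomputable section

open scoped Classical

namespace Summit.ValiantsHypothesis.ValiantsHypothesis.Theorems

namespace ACStability

open Literature.Computability.AlgebraicComplexity

universe u v

variable {K : Type u} {X : Type v} {Yo : Type*} {G : Type*} (D : LabelledArithCircuit K X Yo G)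

/-! ### Heights -/

/-- The height of a gate: `0` for a gate without children, else one more than the maximal height
of a child. [folklore] -/
def height : G → ℕ :=
  D.wf.fix fun g rec => (D.children g).attach.sup fun h => rec h.1 h.2 + 1

/-- The defining equation of `height`. [folklore] -/
theorem height_eq (g : G) : height D g = (D.children g).sup fun h => height D h + 1 := by
  rw [height, WellFounded.fix_eq]
  exact Finset.sup_attach (D.children g) (f := fun h => D.wf.fix _ h + 1)

/-- Children have smaller height. [folklore] -/
theorem height_lt_of_mem_children {g h : G} (hh : h ∈ D.children g) : height D h < height D g := by
  rw [height_eq D g]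
  exact Nat.lt_of_lt_of_le (Nat.lt_succ_self _) (Finset.le_sup (f := fun h => height D h + 1) hh)

/-- A gate of positive height has a child of height one less. [folklore] -/
theorem exists_child_height_eq {g : G} (hg : 0 < height D g) :
    ∃ h ∈ D.children g, height D h + 1 = height D g := by
  have hne : (D.children g).Nonempty := by
    by_contra he
    rw [Finset.not_nonempty_iff_eq_empty] at he
    rw [height_eq, he, Finset.sup_empty] at hg
    exact lt_irrefl _ hg
  obtain ⟨h, hh, hmax⟩ := Finset.exists_mem_eq_sup (D.children g) hne fun h => height D h + 1
  exact ⟨h, hh, by rw [height_eq D g, hmax]⟩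

/-- Below a gate of height `k` there are gates of every height `≤ k` (reachable along wires, hence
in particular in `G`). [folklore] -/
theorem exists_height_eq (g : G) : ∀ k ≤ height D g, ∃ h : G, height D h = k := by
  induction g using D.wf.induction with
  | h g ih =>
    intro k hk
    rcases Nat.eq_or_lt_of_le hk with rfl | hlt
    · exact ⟨g, rfl⟩
    · have hpos : 0 < height D g := by omega
      obtain ⟨h, hh, hh1⟩ := exists_child_height_eq D hpos
      exact ih h hh k (by omega)

/-- **Heights are below the number of gates.** [folklore] -/
theorem height_lt_card [Fintype G] (g : G) : height D g < Fintype.card G := by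
  -- the gates of heights `0, …, height g` are pairwise distinct
  choose f hf using fun k : Fin (height D g + 1) => exists_height_eq D g k.1 (Nat.lt_succ_iff.1 k.2)
  have hinj : Function.Injective f := fun a b hab => Fin.ext (by rw [← hf a, ← hf b, hab])
  have := Fintype.card_le_of_injective f hinj
  simpa using this

/-! ### A topological numbering -/

variable [Fintype G]

/-- The numbering `height g · |G| + idx g` of the gates (`idx` a fixed enumeration of `G`).
[folklore] -/
def topKey (g : G) : ℕ := height D g * Fintype.card G + (Fintype.equivFin G g).1

/-- `topKey` is injective. [folklore] -/
theorem topKey_injective : Function.Injective (topKey D) := by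
  intro a b hab
  unfold topKey at hab
  have ha := (Fintype.equivFin G a).2
  have hb := (Fintype.equivFin G b).2
  have hidx : (Fintype.equivFin G a).1 = (Fintype.equivFin G b).1 := by
    have := congrArg (· % Fintype.card G) hab
    simpa [Nat.add_mod, Nat.mul_mod_left, Nat.mod_eq_of_lt ha, Nat.mod_eq_of_lt hb] using this
  exact (Fintype.equivFin G).injective (Fin.ext hidx)

/-- `topKey` increases along wires. [folklore] -/
theorem topKey_lt_of_mem_children {g h : G} (hh : h ∈ D.children g) : topKey D h < topKey D g := by
  unfold topKey
  have h1 := height_lt_of_mem_children D hh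
  have h2 := (Fintype.equivFin G h).2
  calc height D h * Fintype.card G + (Fintype.equivFin G h).1
      < height D h * Fintype.card G + Fintype.card G := by omega
    _ = (height D h + 1) * Fintype.card G := by ring
    _ ≤ height D g * Fintype.card G := Nat.mul_le_mul_right _ h1
    _ ≤ height D g * Fintype.card G + (Fintype.equivFin G g).1 := Nat.le_add_right _ _

/-- `topKey` is below `|G|²`. [folklore] -/
theorem topKey_lt (g : G) : topKey D g < Fintype.card G * Fintype.card G := by
  unfold topKey
  have h1 := height_lt_card D g
  have h2 := (Fintype.equivFin G g).2
  calc height D g * Fintype.card G + (Fintype.equivFin G g).1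
      < height D g * Fintype.card G + Fintype.card G := by omega
    _ = (height D g + 1) * Fintype.card G := by ring
    _ ≤ Fintype.card G * Fintype.card G := Nat.mul_le_mul_right _ h1

end ACStability

open Literature.Computability.AlgebraicComplexity in
/-- **Topological numbering of a labelled circuit** (registered helper toward the converse of S3″ /
honesty of stub S2″ `stub_proofsToACEquiv`, crux `RestorationQP`): the gates of a Dawar–Wilsenach
circuit on a finite gate type admit an injective numbering below `|G|²` in which children precede
parents. [folklore] -/
theorem proofsToACEquiv_aux_numbering : ∀ (n : ℕ) (G : Type) [Fintype G] (D : LabelledArithCircuit ℂ (Fin n × Fin n) Unit G), ∃ f : G → ℕ, Function.Injective f ∧ (∀ g h : G, h ∈ D.children g → f h < f g) ∧ ∀ g : G, f g < Fintype.card G * Fintype.card G := by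
  intro n G _ D
  exact ⟨ACStability.topKey D, ACStability.topKey_injective D,
    fun g h hh => ACStability.topKey_lt_of_mem_children D hh, ACStability.topKey_lt D⟩

end Summit.ValiantsHypothesis.ValiantsHypothesis.Theorems

end
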